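import Literature.NumberTheory.LFunctions.ConreyIwaniec2002SpacingMechanism
import Literature.NumberTheory.LFunctions.DirichletPolynomialGallagher
import Literature.NumberTheory.LFunctions.HuxleyLargeValuesFourthMomentProofs
import Literature.NumberTheory.LFunctions.DedekindZetaVonMangoldt
import Literature.NumberTheory.QuadraticFields.QuadraticDedekindZetaOddPrimitive
import Mathlib.NumberTheory.LSeries.Injectivity
import HarnessLib

/-!
# Conrey–Iwaniec (2002), §9: the discrete mean square of the mollifier `M(s)`

Conrey–Iwaniec, *Spacing of zeros of Hecke L-functions and the class number problem*, Acta Arith.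
103 (2002), §9, p. 20 [held text `paper:arxiv-math_0111012`, p0020:L14–17]: for the `1`-spaced
points `s = ½ + it` of a dyadic segment `T < t ≤ 2T` and `M(s) = Σ_{m ≤ q⁴} λ*(m) m^{−s}` (9.5),
"`Σ_s |M(s)|² ≪ T(log q) Σ_{m ≤ q⁴} τ²(m) m^{−1} ≪ T(log q)^5`" — the discrete mean value theorem
for Dirichlet polynomials ("Lemma 5.3") together with `|λ*(m)| ≤ τ(m)`.

PROVED HERE (no named fact): `ConreyIwaniec2002.sum_norm_shortInvSum_sq_le`, for `T ≥ q⁴`, with an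
absolute constant. Ingredients (all in the tree): the discrete mean value theorem
`Gallagher.discreteMeanValue` (with `δ = 1`, `N = q⁴`, points in `[−2T, 2T]`), the coefficient
bound `|λ*(m)| ≤ #{𝔞 : N𝔞 = m}` (`norm_twistMoebius_le`), the identity `#{𝔞 : N𝔞 = m} = Σ_{d∣m} χ(d)`
for `K = ℚ(√−q)` — extracted here (`idealNormCount_le_card_divisors_of_quadratic`) from
`ζ_K = ζ·L(·,χ)` (`dedekindZeta_eq_riemannZeta_mul_LFunction_of_odd_primitive`) by the injectivity
of `L`-series — and `Σ_{n ≤ K} d(n)²/n ≤ (1 + log K)⁴` (`ZetaM4D.sum_card_divisors_sq_div_le`).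

## References

* [ConreyIwaniec2002] B. Conrey, H. Iwaniec, Acta Arith. 103 (2002) 259–312, arXiv:math/0111012:
  §9 (9.3)–(9.5), p. 20 (before Proposition 9.1).
-/

noncomputable section

open scoped NumberField LSeries.notation
open Complex

namespace Literature.NumberTheory.LFunctions

namespace ConreyIwaniec2002

open NumberField

/-- **`#{𝔞 ⊂ 𝓞_K : N𝔞 = n} ≤ d(n)` for the imaginary quadratic field of discriminant `−q`**
(`K = ℚ(√−q)`, `χ = (−q/·)` the odd primitive quadratic character mod `q`): the coefficients of
`ζ_K(s) = ζ(s)L(s,χ)` are `τ(n,χ) = Σ_{d∣n} χ(d)` ((6.42)–(6.43)), of modulus at most `d(n)`.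
[cite: ConreyIwaniec2002, §6 (6.42)–(6.43)] -/
theorem idealNormCount_le_card_divisors_of_quadratic {q : ℕ} [NeZero q]
    {χ : DirichletCharacter ℂ q} (hprim : χ.IsPrimitive) (hquad : χ.IsQuadratic) (hodd : χ.Odd)
    (K : Type*) [Field K] [NumberField K] (h2 : Module.finrank ℚ K = 2)
    (hdisc : NumberField.discr K = -(q : ℤ)) {n : ℕ} (hn : n ≠ 0) :
    (idealNormCount K n : ℝ) ≤ n.divisors.card := by
  -- the two coefficient sequences
  set f : ℕ → ℂ := fun n => (idealNormCount K n : ℂ) with hf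
  set g : ℕ → ℂ := (1 : ℕ → ℂ) ⍟ (fun n => χ n) with hg
  -- both `L`-series converge somewhere
  have hfabs : LSeries.abscissaOfAbsConv f < ⊤ :=
    lt_of_le_of_lt (abscissaOfAbsConv_idealNormCount_le K) (by exact_mod_cast EReal.coe_lt_top 1)
  have h2re : (1 : ℝ) < (2 : ℂ).re := by norm_num
  have hgsum : LSeriesSummable g 2 :=
    (LSeriesSummable_one_iff.mpr h2re).convolution (DirichletCharacter.LSeriesSummable_of_one_lt_re χ h2re)
  have hgabs : LSeries.abscissaOfAbsConv g < ⊤ :=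
    lt_of_le_of_lt hgsum.abscissaOfAbsConv_le (EReal.coe_lt_top _)
  -- they agree for real `x > 1`
  have heq : (fun x : ℝ => LSeries f x) =ᶠ[Filter.atTop] fun x => LSeries g x := by
    filter_upwards [Filter.eventually_gt_atTop 1] with x hx
    have hx' : 1 < (x : ℂ).re := by simpa using hx
    have h1 := Literature.NumberTheory.QuadraticFields.Quadratic.dedekindZeta_eq_riemannZeta_mul_LFunction_of_odd_primitive
      (K := K) hprim hquad hodd h2 hdisc hx'
    rw [dedekindZeta_eq_LSeries] at h1
    rw [hf, h1, hg, LSeries_convolution' (LSeriesSummable_one_iff.mpr hx')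
      (DirichletCharacter.LSeriesSummable_of_one_lt_re χ hx'), LSeries_one_eq_riemannZeta hx',
      DirichletCharacter.LFunction_eq_LSeries χ hx']
  have hcoef : f n = g n := LSeries.eq_of_LSeries_eventually_eq hfabs hgabs heq hn
  -- `g n = Σ_{d ∣ n} χ(d)`
  have hgn : g n = divisorSumChar χ n := by
    rw [hg, LSeries.convolution_def, divisorSumChar_apply]
    beta_reduce
    rw [Nat.sum_divisorsAntidiagonal' (f := fun a b => (1 : ℕ → ℂ) a * χ b)]
    simp
  have hnorm : (idealNormCount K n : ℝ) = ‖f n‖ := by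
    rw [hf]; simp
  rw [hnorm, hcoef, hgn]
  exact norm_divisorSumChar_le χ n

/-- **The discrete mean square of the mollifier.** For `1`-spaced points `s = ½ + it`,
`t ∈ S ⊂ (T, 2T]`, `T ≥ q⁴`: `Σ_{t∈S} |M(½+it)|² ≤ C·T(log q)^5`, `M(s) = Σ_{m≤q⁴} λ*(m)m^{−s}`
("`Σ_s|M(s)|² ≪ T(log q)Σ_{m≤q⁴}τ²(m)m^{−1} ≪ T(log q)^5`"), with an absolute `C`.
[cite: ConreyIwaniec2002, §9 (before Proposition 9.1), p. 20] -/
theorem sum_norm_shortInvSum_sq_le :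
    ∃ C : ℝ, 0 < C ∧
    ∀ (q : ℕ) [NeZero q], 4 < q → Odd q → ∀ χ : DirichletCharacter ℂ q,
      χ.IsPrimitive → χ.IsQuadratic → χ.Odd →
        ∀ (K : Type) [Field K] [NumberField K],
          Module.finrank ℚ K = 2 → NumberField.discr K = -(q : ℤ) →
            ∀ (ψ : ClassGroup (𝓞 K) →* ℂˣ) (T : ℝ) (S : Finset ℝ),
              (q : ℝ) ^ (4 : ℕ) ≤ T → IsDyadicPointSet S T →
                ∑ t ∈ S, ‖shortInvSum K ψ q (1 / 2 + t * I)‖ ^ 2 ≤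
                  C * (T * Real.log q ^ (5 : ℕ)) := by
  refine ⟨100000, by norm_num, fun q _ hq _ χ hprim hquad hodd K _ _ h2 hdisc ψ T S hT hS => ?_⟩
  classical
  have hq0 : 0 < q := by omega
  have hq5 : (5 : ℝ) ≤ q := by exact_mod_cast hq
  have hℓ1 : 1 ≤ Real.log q := by
    rw [Real.le_log_iff_exp_le (by linarith)]
    exact Real.exp_one_lt_d9.le.trans (by linarith)
  set ℓ : ℝ := Real.log q with hℓdef
  set N : ℕ := q ^ 4 with hNdef
  have hNpos : 0 < N := pow_pos hq0 4
  have hNreal : (N : ℝ) = (q : ℝ) ^ (4 : ℕ) := by rw [hNdef]; push_cast; ring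
  have hT1 : (1 : ℝ) ≤ T := le_trans (by rw [← hNreal]; exact_mod_cast hNpos) hT
  have hT0 : 0 < T := by linarith
  have hlogN : Real.log N = 4 * ℓ := by rw [hNreal, Real.log_pow]; push_cast; ring
  -- the coefficients `a(m) = λ*(m) m^{-1/2}`
  set ν := classGroupCharIdealHom ψ with hνdef
  set a : ℕ → ℂ := fun m => twistMoebius K ν m * (m : ℂ) ^ (-(1 / 2 : ℂ)) with hadef
  -- `M(½+it) = Σ a(m) m^{-it}`
  have hM : ∀ t : ℝ, shortInvSum K ψ q (1 / 2 + t * I) =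
      ∑ m ∈ Finset.Icc 1 N, a m * (m : ℂ) ^ (-((t : ℂ) * I)) := by
    intro t
    unfold shortInvSum
    refine Finset.sum_congr rfl fun m hm => ?_
    rw [Finset.mem_Icc] at hm
    have hm0 : (m : ℂ) ≠ 0 := by exact_mod_cast (by omega : m ≠ 0)
    rw [hadef, neg_add, Complex.cpow_add _ _ hm0]
    simp only
    ring
  -- the discrete mean value theorem on `[−2T, 2T]`, `δ = 1`
  have hmem : ∀ t ∈ S, |t| ≤ 2 * T := by
    intro t ht
    have h := hS.mem_bounds ht
    rw [abs_of_pos (by linarith [h.1])]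
    exact h.2
  have hsep : ∀ t ∈ S, ∀ t' ∈ S, t ≠ t' → (1 : ℝ) ≤ |t - t'| := fun t ht t' ht' h => hS.2 t ht t' ht' h
  have hG := Gallagher.discreteMeanValue a N (by positivity : (0 : ℝ) < 2 * T) one_pos S hmem hsep
  simp_rw [← hM] at hG
  -- the coefficient sum `Σ |a(m)|² ≤ Σ d(m)²/m ≤ (1 + 4ℓ)^4`
  have hcoef : ∑ m ∈ Finset.Icc 1 N, ‖a m‖ ^ 2 ≤ (1 + 4 * ℓ) ^ 4 := by
    calc ∑ m ∈ Finset.Icc 1 N, ‖a m‖ ^ 2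
        ≤ ∑ m ∈ Finset.Icc 1 N, (m.divisors.card : ℝ) ^ 2 / m := by
          refine Finset.sum_le_sum fun m hm => ?_
          rw [Finset.mem_Icc] at hm
          have hm0 : m ≠ 0 := by omega
          have hmpos : (0 : ℝ) < m := by exact_mod_cast (by omega : 0 < m)
          have hnorm : ‖a m‖ = ‖twistMoebius K ν m‖ * (m : ℝ) ^ (-(1 / 2 : ℝ)) := by
            rw [hadef]
            simp only [norm_mul]
            congr 1
            rw [show (-(1 / 2 : ℂ)) = ((-(1 / 2 : ℝ) : ℝ) : ℂ) by push_cast; ring,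
              Complex.norm_natCast_cpow_of_pos (by omega), Complex.ofReal_re]
          have hlam : ‖twistMoebius K ν m‖ ≤ (m.divisors.card : ℝ) :=
            (norm_twistMoebius_le (norm_classGroupCharIdealHom_le ψ) m).trans
              (idealNormCount_le_card_divisors_of_quadratic hprim hquad hodd K h2 hdisc hm0)
          rw [hnorm, mul_pow]
          have hpow : ((m : ℝ) ^ (-(1 / 2 : ℝ))) ^ 2 = 1 / m := by
            rw [← Real.rpow_natCast, ← Real.rpow_mul hmpos.le]
            norm_num
            rw [Real.rpow_neg_one]
          rw [hpow, ← div_eq_mul_one_div]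
          gcongr
      _ ≤ (1 + Real.log N) ^ 4 := ZetaM4D.sum_card_divisors_sq_div_le N
      _ = (1 + 4 * ℓ) ^ 4 := by rw [hlogN]
  -- assemble: `(5(2T + 1/2) + 18 q⁴)(1 + 4ℓ) (1 + 4ℓ)^4 ≤ 10⁵ T ℓ^5`
  have hN_le : (N : ℝ) ≤ T := by rw [hNreal]; exact hT
  have hfac1 : 5 * (2 * T + 1 / 2) + 18 * (N : ℝ) ≤ 31 * T := by nlinarith
  have hfac2 : (1 : ℝ)⁻¹ + Real.log N ≤ 5 * ℓ := by rw [hlogN, inv_one]; linarith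
  have hfac3 : (1 + 4 * ℓ) ^ 4 ≤ (5 * ℓ) ^ 4 := by
    apply pow_le_pow_left₀ (by positivity); linarith
  calc ∑ t ∈ S, ‖shortInvSum K ψ q (1 / 2 + t * I)‖ ^ 2
      ≤ (5 * (2 * T + 1 / 2) + 18 * N) * ((1 : ℝ)⁻¹ + Real.log N) *
          ∑ m ∈ Finset.Icc 1 N, ‖a m‖ ^ 2 := hG
    _ ≤ (31 * T) * (5 * ℓ) * (5 * ℓ) ^ 4 := by
        have h0 : 0 ≤ ∑ m ∈ Finset.Icc 1 N, ‖a m‖ ^ 2 := Finset.sum_nonneg fun _ _ => by positivity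
        have h1 : 0 ≤ (1 : ℝ)⁻¹ + Real.log N := by rw [hlogN, inv_one]; positivity
        gcongr
        · exact hcoef.trans hfac3
    _ = 96875 * (T * ℓ ^ 5) := by ring
    _ ≤ 100000 * (T * ℓ ^ 5) := by
        have : 0 ≤ T * ℓ ^ 5 := by positivity
        nlinarith

end ConreyIwaniec2002

end Literature.NumberTheory.LFunctions

end
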